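import Mathlib.Geometry.Manifold.ContMDiffMFDeriv
import Literature.Geometry.Lorentzian.GeodesicProofs
import HarnessLib

/-!
# The set where two `C¹` maps agree to first order is closed; the open–closed argument
# (O'Neill 1983, Ch. 3, proof of Prop. 3.62; Sbierski 2016, §3.1, proof of the first lemma)

First step towards the one-jet rigidity of isometric immersions (O'Neill, *Semi-Riemannian
geometry* (1983), Ch. 3, Prop. 3.62; Sbierski, Ann. Henri Poincaré 17 (2016) = arXiv:1309.7591,
§3.1, first lemma: "Let `(M, g)` and `(M', g')` be Lorentzian manifolds, where `M` is connected.
Furthermore, let `ψ₁, ψ₂ : M → M'` be two isometric immersions with `ψ₁(p) = ψ₂(p)` and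
`dψ₁(p) = dψ₂(p)` for some `p ∈ M`. It then follows that `ψ₁ = ψ₂`"), whose printed proof is: "One
shows that the set `A = {x ∈ M | ψ₁(x) = ψ₂(x) and dψ₁(x) = dψ₂(x)}` is open, closed and non-empty
… The closedness of `A` follows from the smoothness of `ψ₁` and `ψ₂`, and non-emptyness holds by
assumption." This file proves, for arbitrary `C¹` maps between real manifolds (no metric):

* `oneJet_eq_iff_tangentMap_eq` — the one-jets of `ψ₁, ψ₂` agree at `x` iff their tangent maps
  agree on the fibre `T_x M`;
* `isClosed_setOf_oneJet_eq` — **`A` is closed** when `M'` is Hausdorff: the equaliser `B ⊆ TM`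
  of the (continuous) tangent maps is closed in the Hausdorff space `TM'`, and
  `M ∖ A = π(TM ∖ B)` is open because the bundle projection is an open map;
* `eq_of_oneJet_eq_of_locally_eq` — **the open–closed argument**: on a connected `M`, if the
  one-jets agree at one point and agreement of one-jets at a point forces `ψ₁ = ψ₂` near that
  point (the geodesic step of the printed proof, to be supplied), then `ψ₁ = ψ₂`.

## References

* B. O'Neill, *Semi-Riemannian geometry with applications to relativity*, Academic Press 1983,
  Ch. 3, Prop. 3.62 (p. 91) and its proof.
* J. Sbierski, *On the existence of a maximal Cauchy development for the Einstein equations: a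
  dezornification*, Ann. Henri Poincaré 17 (2016) 301–329 = arXiv:1309.7591, §3.1, first lemma.
-/

noncomputable section

open Bundle Set Filter Function
open scoped Manifold ContDiff Topology

namespace Literature.Geometry.Lorentzian

variable {E : Type*} [NormedAddCommGroup E] [NormedSpace ℝ E] {H : Type*} [TopologicalSpace H]
  {I : ModelWithCorners ℝ E H} {M : Type*} [TopologicalSpace M] [ChartedSpace H M]
  [IsManifold I ∞ M]
  {E' : Type*} [NormedAddCommGroup E'] [NormedSpace ℝ E'] {H' : Type*} [TopologicalSpace H']
  {I' : ModelWithCorners ℝ E' H'} {M' : Type*} [TopologicalSpace M'] [ChartedSpace H' M']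
  [IsManifold I' ∞ M']

omit [IsManifold I ∞ M] [IsManifold I' ∞ M'] in
/-- The one-jets of `ψ₁, ψ₂ : M → M'` agree at `x` (`ψ₁ x = ψ₂ x` and `dψ₁ₓ = dψ₂ₓ`) iff their
tangent maps agree on the fibre of `TM` over `x`. [folklore] -/
theorem oneJet_eq_iff_tangentMap_eq {ψ₁ ψ₂ : M → M'} {x : M} :
    (ψ₁ x = ψ₂ x ∧ mfderiv I I' ψ₁ x = mfderiv I I' ψ₂ x) ↔
      ∀ v : TangentSpace I x, tangentMap I I' ψ₁ ⟨x, v⟩ = tangentMap I I' ψ₂ ⟨x, v⟩ := by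
  constructor
  · rintro ⟨h0, hd⟩ v
    exact TotalSpace.ext h0 (heq_of_eq (congrArg (fun L ↦ L v) hd))
  · intro h
    refine ⟨congrArg TotalSpace.proj (h 0), ContinuousLinearMap.ext fun v ↦ ?_⟩
    exact eq_of_heq (TotalSpace.ext_iff.mp (h v)).2

/-- **The set where two `C¹` maps agree to first order is closed** (for a Hausdorff target): the
equaliser `B = {ξ ∈ TM | Tψ₁ ξ = Tψ₂ ξ}` of the continuous tangent maps is closed (`TM'` is
Hausdorff), `A = {x | π⁻¹(x) ⊆ B}`, and `M ∖ A = π(TM ∖ B)` is open since the projection of a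
fibre bundle is an open map. This is "the closedness of `A` follows from the smoothness of `ψ₁`
and `ψ₂`" in the proof of Sbierski 2016, §3.1, first lemma; O'Neill 1983, Ch. 3, proof of
Prop. 3.62. [cite: ONeillSemiRiemannian1983, Ch. 3, Prop. 3.62 (proof)] -/
theorem isClosed_setOf_oneJet_eq [T2Space M'] {n : ℕ∞ω} {ψ₁ ψ₂ : M → M'}
    (h₁ : ContMDiff I I' n ψ₁) (h₂ : ContMDiff I I' n ψ₂) (hn : 1 ≤ n) :
    IsClosed {x | ψ₁ x = ψ₂ x ∧ mfderiv I I' ψ₁ x = mfderiv I I' ψ₂ x} := by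
  haveI : T2Space (TangentBundle I' M') := t2Space_totalSpace
  have hB : IsClosed {ξ : TangentBundle I M | tangentMap I I' ψ₁ ξ = tangentMap I I' ψ₂ ξ} :=
    isClosed_eq (h₁.continuous_tangentMap hn) (h₂.continuous_tangentMap hn)
  have hA : {x | ψ₁ x = ψ₂ x ∧ mfderiv I I' ψ₁ x = mfderiv I I' ψ₂ x} =
      ((π E (TangentSpace I)) ''
        {ξ : TangentBundle I M | tangentMap I I' ψ₁ ξ = tangentMap I I' ψ₂ ξ}ᶜ)ᶜ := by
    ext x
    rw [mem_setOf_eq, oneJet_eq_iff_tangentMap_eq, mem_compl_iff, mem_image]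
    push Not
    constructor
    · rintro h ⟨x', v⟩ hξ (rfl : x' = x)
      exact hξ (h v)
    · intro h v
      by_contra hv
      exact h ⟨x, v⟩ hv rfl
  rw [hA]
  exact (FiberBundle.isOpenMap_proj E (TangentSpace I : M → Type _) _ hB.isOpen_compl).isClosed_compl

/-- **The open–closed argument of O'Neill's Prop. 3.62** (Sbierski 2016, §3.1, proof of the first
lemma: "the set `A` … is open, closed and non-empty, from which it then follows that `A = M`").
Let `ψ₁, ψ₂ : M → M'` be `C¹`, `M` connected, `M'` Hausdorff, with equal one-jets at one point
`p`. If equality of one-jets at any point `x` forces `ψ₁ = ψ₂` on a neighbourhood of `x` (the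
geodesic step: "`φ ∘ exp = exp ∘ dφ`"), then `ψ₁ = ψ₂`: the set `A` of points with equal one-jets
is closed (`isClosed_setOf_oneJet_eq`), open (near a point of `A` the maps agree on a
neighbourhood, hence so do their one-jets, `Filter.EventuallyEq.mfderiv_eq`) and nonempty.
[cite: ONeillSemiRiemannian1983, Ch. 3, Prop. 3.62 (proof)] -/
theorem eq_of_oneJet_eq_of_locally_eq [T2Space M'] [ConnectedSpace M] {n : ℕ∞ω} {ψ₁ ψ₂ : M → M'}
    (h₁ : ContMDiff I I' n ψ₁) (h₂ : ContMDiff I I' n ψ₂) (hn : 1 ≤ n) {p : M} (hp : ψ₁ p = ψ₂ p)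
    (hdp : mfderiv I I' ψ₁ p = mfderiv I I' ψ₂ p)
    (hloc : ∀ x, ψ₁ x = ψ₂ x → mfderiv I I' ψ₁ x = mfderiv I I' ψ₂ x → ψ₁ =ᶠ[𝓝 x] ψ₂) :
    ψ₁ = ψ₂ := by
  have hAc := isClosed_setOf_oneJet_eq h₁ h₂ hn
  have hAo : IsOpen {x | ψ₁ x = ψ₂ x ∧ mfderiv I I' ψ₁ x = mfderiv I I' ψ₂ x} := by
    rw [isOpen_iff_mem_nhds]
    rintro x ⟨hx, hdx⟩
    filter_upwards [(hloc x hx hdx).eventually_nhds] with y (hy : ψ₁ =ᶠ[𝓝 y] ψ₂)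
    exact ⟨hy.eq_of_nhds, hy.mfderiv_eq⟩
  have hAu := IsClopen.eq_univ ⟨hAc, hAo⟩ ⟨p, hp, hdp⟩
  funext x
  exact ((eq_univ_iff_forall.mp hAu) x).1

end Literature.Geometry.Lorentzian

end
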